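/-
Copyright (c) 2026 the pub-hodgecm-mathlib formalisation cell (harness21).  Prover seat hodgecm-mathlib-K2Liu-p13 (g3), Track B «K2-LIT»,
#184♮ = hLiu418 = `stmt-HodgeConjecture-24832`; ROAD Φ (RULING «M-156n»), consumer sheet fa2b1e3a29709f09 row G6-fin «Φ8 FACE PACKAGING», clauses (ii)∕(v)
of the big-cell package (LEAD F0P6-plan (g14) BATCH #30; K2E5-plan (g7) co-deal 2026-09-04T14:22:38Z (C) (F4)); census
`K2/K2Liu-p13/g3/CENSUS-G6fin-Phi8FacePackaging.K2Liu-p13-g3.md` 065e2d080ef468d9 (F4).  THEOREMS ONLY (no `def`, no `instance`, no named-fact hypothesis,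
no `sorry`); hypothesis-first (every face BY VALUE); Mathlib only.
-/
import Summits.HodgeConjecture.HodgeConjecture.Theorems.K2LiuBigCellPackageOfFaces   -- ★ `exists_ball_norm_le_of_differentiableOn`
import Mathlib.Analysis.Complex.CauchyIntegral
import Mathlib.Analysis.Complex.Convex
import Mathlib.Analysis.Convex.PathConnected
import Mathlib.Analysis.SpecialFunctions.Pow.Real
import HarnessLib

/-!
# Crux `HLiu418`, ROAD Φ, organ Φ8 (sheet row G6-fin): MODERATE GROWTH OF A CONTINUED INDUCED FAMILY FROM EQUIVARIANCE — the clauses (v) (growth) and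
# «equivariance on all of `{0 < re}`» of the big-cell package, with NO local analysis

Cell `hodgecm-mathlib`, crux item hLiu418 = `stmt-HodgeConjecture-24832` (helper lane, count-neutral).  The big cell `M(s)f_s(h) = ∫_{N_Δ(𝔸)} f_s(w_Δ u h) du`
of the constant term of the doubled Siegel Eisenstein series (★ D9 `intertwiningDelta`) lies, for `re s > n∕2`, in the induced space `I(−s, χ^{w})`:
`M(s)f_s(p h) = ω_s(p)·M(s)f_s(h)` for `p ∈ P_Δ(𝔸)` with `|ω_s(p)| = |det_Δ p|_𝔸^{n∕2 − re s}` (the global intertwining property; local twin ★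
`K2LiuLocalIntertwiningProperty.isLocalSiegelSection_localIntertwining_of_modulus`).  Once the big cell is CONTINUED in `s` (pointwise in `h`, clause (i) of
its term package, ★ `K2LiuBigCellPackageOfFaces`), three soft facts give its locally uniform MODERATE GROWTH `‖E(s,h)‖ ≤ C‖h‖^A` on the whole half-plane
`{0 < re}` — with no estimate of any local intertwining operator:
* (EQ) the equivariance PERSISTS to the continuation (identity principle in `s`, pointwise in `h`: both sides are holomorphic);
* (IW) the Iwasawa decomposition `H(𝔸) = P_Δ(𝔸)·K` with `K` COMPACT (★ `K2LiuSiegelDoubledIwasawaCompact.exists_isCompact_isSiegelDelta_mul`), so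
  `‖E(s, p k)‖ = ‖ω_s(p)‖·‖E(s,k)‖ ≤ C·‖p‖^A · sup_K ‖E(s,·)‖`, and `‖p‖ ≤ C_K‖p k‖` (★ `adelicHeightGL_mul_le_const`, ★ `adelicHeightGL_inv`, compactness);
  the bound `‖ω_s(p)‖ ≤ C‖p‖^A` locally uniformly in `s` is the `modDelta`-versus-height comparison (letter `K2LiuModDeltaHeightComparison`);
* (KF) a bound for `E(s,·)` on `K`, locally uniform in `s` — which for a `K`-FINITE family is again pure algebra: on the convergence half-plane `E(s,·)|_K`
  lies in a fixed finite-dimensional space of functions on `K`, so `E(s,k) = Σ_i E(s,k_i)·ψ_i(k)` for finitely many points `k_i ∈ K` and bounded `ψ_i`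
  (a POINT REPRESENTATION), an identity which also persists to the continuation; then `sup_K ‖E(s,·)‖ ≤ Σ_i (‖E(z,k_i)‖ + 1)·sup‖ψ_i‖` near `z`.
THIS FILE proves these implications for an ABSTRACT group `H` (no topology needed), subsets `P, K ⊆ H`, a height `H → ℝ_{≥0}`, a character `ω : ℂ → H → ℂ` and a
family `E : ℂ → H → ℂ`, every input BY VALUE:
* §1 `eqOn_halfPlane_of_eqOn` — identity principle between half-planes;
* §2 `equivariant_of_halfPlane` — (EQ);  §3 `pointRepr_of_halfPlane`, `exists_bound_on_of_pointRepr` — (KF);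
* §4 **`growth_of_equivariance`** — (IW): growth (v) in the exact currency of ★ Φ9 `K2LiuSiegelEisensteinAssembly` ∕ ★ `K2LiuBigCellPackageOfFaces` (`hMg`),
  from equivariance on `{0 < re}`, the `ω`-bound, the Iwasawa decomposition, the height comparison `‖p‖ ≤ C_K‖p k‖` and a bound on `K`;
* §5 **`growth_of_equivariance_of_pointRepr`** — everything from the CONVERGENCE HALF-PLANE: (i) + equivariance and point representation on `{c < re}` ⇒ (v).
Consumers: the instantiation of ★ `exists_bigCell_package` (its binder `hMg`), and — same shape — the rank-one term `T₁⋆` of the S5 top and the `I(−s)`-valued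
residue forms of Road I.
Sources: [MoeglinWaldspurger1995, I.2.17 (moderate growth of induced functions via `G = PK`), II.1.6, IV.1.9]; [BorelJacquet1979, §1.2]; [Tan1999, §1, §4 Prop. 4.8];
[HarrisKudlaSweet1996, §1 (1.11)–(1.15)].
HONEST LABEL.  Helper lemmas, count-neutral; `HC_CM` is proved only modulo the 7 printed citations (2 remaining named inputs:
hLiu418 = `stmt-HodgeConjecture-24832`, h413 = `stmt-HodgeConjecture-24833`) until rung 0 closes.
-/

set_option autoImplicit false
set_option linter.dupNamespace false -- the mandated namespace repeats `HodgeConjecture.HodgeConjecture`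

noncomputable section

namespace Summit.HodgeConjecture.HodgeConjecture.Cruxes.HLiu418.K2LiuBigCellGrowthOfEquivariance

open Set Filter Topology Metric Complex
open scoped BigOperators
open K2LiuBigCellPackageOfFaces (exists_ball_norm_le_of_differentiableOn)

/-! ## §1 The identity principle between half-planes -/

/-- Two functions holomorphic on `{a < re}` which agree on `{c < re}` (`a ≤ c`) agree on `{a < re}` (the open half-plane is connected and the smaller one is
a non-empty open subset). [folklore] -/
theorem eqOn_halfPlane_of_eqOn {E₁ E₂ : ℂ → ℂ} {a c : ℝ} (hac : a ≤ c)
    (h₁ : DifferentiableOn ℂ E₁ {s : ℂ | a < s.re}) (h₂ : DifferentiableOn ℂ E₂ {s : ℂ | a < s.re})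
    (heq : ∀ s : ℂ, c < s.re → E₁ s = E₂ s) : EqOn E₁ E₂ {s : ℂ | a < s.re} := by
  have hΩ : IsOpen {s : ℂ | a < s.re} := isOpen_lt continuous_const Complex.continuous_re
  have hz₁c : c < ((c + 1 : ℝ) : ℂ).re := by simp
  have hz₁ : ((c + 1 : ℝ) : ℂ) ∈ {s : ℂ | a < s.re} := by
    show a < ((c + 1 : ℝ) : ℂ).re
    simp only [Complex.ofReal_re]; linarith
  have hev : E₁ =ᶠ[𝓝 ((c + 1 : ℝ) : ℂ)] E₂ := by
    filter_upwards [(isOpen_lt continuous_const Complex.continuous_re).mem_nhds hz₁c] with s hs using heq s hs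
  exact (h₁.analyticOnNhd hΩ).eqOn_of_preconnected_of_eventuallyEq (h₂.analyticOnNhd hΩ)
    (convex_halfSpace_re_gt a).isPreconnected hz₁ hev

variable {H : Type*} [Mul H]

/-! ## §2 (EQ) Equivariance persists to the continuation -/

/-- **(EQ) EQUIVARIANCE PERSISTS.**  If `s ↦ E s x` is holomorphic on `{0 < re}` for every `x`, `s ↦ ω s p` is holomorphic on `{0 < re}` for every `p ∈ P`, and
`E s (p * x) = ω s p * E s x` holds for `c < re s` (`0 ≤ c`; for the big cell: the intertwining property `M(s)f_s ∈ I(−s, χ^w)` on the convergence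
half-plane), then it holds for all `0 < re s`. [cite: MoeglinWaldspurger1995, IV.1.9] [cite: HarrisKudlaSweet1996, §1 (1.11)–(1.15)] -/
theorem equivariant_of_halfPlane {P : Set H} {ω : ℂ → H → ℂ} {E : ℂ → H → ℂ} {c : ℝ} (hc : 0 ≤ c)
    (hEd : ∀ x, DifferentiableOn ℂ (fun s => E s x) {s : ℂ | 0 < s.re})
    (hωd : ∀ p ∈ P, DifferentiableOn ℂ (fun s => ω s p) {s : ℂ | 0 < s.re})
    (heqv : ∀ s : ℂ, c < s.re → ∀ p ∈ P, ∀ x, E s (p * x) = ω s p * E s x) :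
    ∀ s : ℂ, 0 < s.re → ∀ p ∈ P, ∀ x, E s (p * x) = ω s p * E s x := by
  intro s hs p hp x
  exact eqOn_halfPlane_of_eqOn hc (hEd (p * x)) ((hωd p hp).mul (hEd x)) (fun s' hs' => heqv s' hs' p hp x) hs

/-! ## §3 (KF) Point representations persist; a bound on `K` -/

omit [Mul H] in
/-- **(KF-1) A POINT REPRESENTATION PERSISTS.**  If on the convergence half-plane `E s k = Σ_i E s (kpt i) · ψ i k` for all `k ∈ K` (finitely many points
`kpt i`, fixed functions `ψ i` — the expansion of a `K`-finite family in point evaluations), and every `s ↦ E s x` is holomorphic on `{0 < re}`, the same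
identity holds on `{0 < re}`. [cite: MoeglinWaldspurger1995, I.2.17] [cite: BorelJacquet1979, §1.2] -/
theorem pointRepr_of_halfPlane {ι : Type*} [Fintype ι] {K : Set H} {kpt : ι → H} {ψ : ι → H → ℂ} {E : ℂ → H → ℂ} {c : ℝ} (hc : 0 ≤ c)
    (hEd : ∀ x, DifferentiableOn ℂ (fun s => E s x) {s : ℂ | 0 < s.re})
    (hrep : ∀ s : ℂ, c < s.re → ∀ k ∈ K, E s k = ∑ i, E s (kpt i) * ψ i k) :
    ∀ s : ℂ, 0 < s.re → ∀ k ∈ K, E s k = ∑ i, E s (kpt i) * ψ i k := by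
  intro s hs k hk
  have h₂ : DifferentiableOn ℂ (fun s => ∑ i, E s (kpt i) * ψ i k) {s : ℂ | 0 < s.re} :=
    DifferentiableOn.fun_sum fun i _ => (hEd (kpt i)).mul_const _
  exact eqOn_halfPlane_of_eqOn hc (hEd k) h₂ (fun s' hs' => hrep s' hs' k hk) hs

omit [Mul H] in
/-- **(KF-2) A BOUND ON `K`, LOCALLY UNIFORM IN `s`**, from a point representation on `{0 < re}` with bounded `ψ i` on `K`:
`‖E s k‖ ≤ Σ_i (‖E z (kpt i)‖ + 1)·B` for `s` near `z`, `k ∈ K`. [cite: MoeglinWaldspurger1995, I.2.17] -/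
theorem exists_bound_on_of_pointRepr {ι : Type*} [Fintype ι] {K : Set H} {kpt : ι → H} {ψ : ι → H → ℂ} {E : ℂ → H → ℂ}
    (hEd : ∀ x, DifferentiableOn ℂ (fun s => E s x) {s : ℂ | 0 < s.re})
    (hrep : ∀ s : ℂ, 0 < s.re → ∀ k ∈ K, E s k = ∑ i, E s (kpt i) * ψ i k)
    {B : ℝ} (hB : 0 ≤ B) (hψ : ∀ i, ∀ k ∈ K, ‖ψ i k‖ ≤ B) :
    ∀ z : ℂ, 0 < z.re → ∃ M ρ : ℝ, 0 ≤ M ∧ 0 < ρ ∧ ∀ s : ℂ, dist s z < ρ → ∀ k ∈ K, ‖E s k‖ ≤ M := by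
  classical
  intro z hz
  -- a common radius on which every `E · (kpt i)` is bounded by `‖E z (kpt i)‖ + 1`
  have hball : ∀ i, ∃ ρ : ℝ, 0 < ρ ∧ ∀ s : ℂ, dist s z < ρ → ‖E s (kpt i)‖ ≤ ‖E z (kpt i)‖ + 1 :=
    fun i => exists_ball_norm_le_of_differentiableOn (hEd (kpt i)) hz
  choose ρ hρ hle using hball
  refine ⟨∑ i, (‖E z (kpt i)‖ + 1) * B, if h : Nonempty ι then (Finset.univ.image ρ).min' (by simp) ⊓ z.re else z.re,
    Finset.sum_nonneg fun i _ => by positivity, ?_, fun s hs k hk => ?_⟩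
  · split_ifs with h
    · refine lt_min ?_ hz
      obtain ⟨i, hi, heq⟩ := Finset.mem_image.1 ((Finset.univ.image ρ).min'_mem (by simp))
      rw [← heq]; exact hρ i
    · exact hz
  · rw [hrep s ?_ k hk]
    · refine (norm_sum_le _ _).trans (Finset.sum_le_sum fun i _ => ?_)
      have hne : Nonempty ι := ⟨i⟩
      have hsi : dist s z < ρ i := by
        rw [dif_pos hne] at hs
        exact lt_of_lt_of_le hs ((min_le_left _ _).trans (Finset.min'_le _ _ (Finset.mem_image_of_mem ρ (Finset.mem_univ i))))
      rw [norm_mul]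
      exact mul_le_mul (hle i s hsi) (hψ i k hk) (norm_nonneg _) (by positivity)
    · -- `0 < re s` on the disc of radius `≤ re z`
      have hsz : dist s z < z.re := by
        split_ifs at hs with h
        · exact lt_of_lt_of_le hs (min_le_right _ _)
        · exact hs
      have h1 : |s.re - z.re| ≤ dist s z := by
        rw [Complex.dist_eq]; simpa using Complex.abs_re_le_norm (s - z)
      have h2 := (abs_lt.1 (lt_of_le_of_lt h1 hsz)).1
      linarith

/-! ## §4 (IW) Growth from equivariance -/

/-- **(IW) MODERATE GROWTH FROM EQUIVARIANCE.**  DATA (by value): subsets `P, K ⊆ H` with `H = P·K` (`hIw`; Iwasawa, `K` compact); a height `height : H → ℝ_{≥0}`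
with `height p ≤ C_K·height (p * k)` for `p ∈ P`, `k ∈ K` (compactness of `K` + submultiplicativity); a character bound `‖ω s p‖ ≤ C·height p^A` near every
`z` (`0 < re z`; the `modDelta`-versus-height comparison); a bound `‖E s k‖ ≤ M` on `K` near every `z`; and the equivariance `E s (p * x) = ω s p · E s x` on
`{0 < re}`.  THEN `‖E s x‖ ≤ C'·height x^{A}` near every `z` — clause (v) of the big-cell package (binder `hMg` of ★ `K2LiuBigCellPackageOfFaces.exists_bigCell_package`).
[cite: MoeglinWaldspurger1995, I.2.17, II.1.6] [cite: BorelJacquet1979, §1.2] [cite: Tan1999, §4 Prop. 4.8] -/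
theorem growth_of_equivariance {P K : Set H} (hIw : ∀ x : H, ∃ p ∈ P, ∃ k ∈ K, x = p * k)
    (height : H → ℝ) (hnn : ∀ x, 0 ≤ height x) {CK : ℝ} (hCK : 0 ≤ CK) (hPK : ∀ p ∈ P, ∀ k ∈ K, height p ≤ CK * height (p * k))
    {ω : ℂ → H → ℂ} (hω : ∀ z : ℂ, 0 < z.re → ∃ C A ρ : ℝ, 0 ≤ C ∧ 0 ≤ A ∧ 0 < ρ ∧ ∀ s : ℂ, dist s z < ρ → ∀ p ∈ P, ‖ω s p‖ ≤ C * height p ^ A)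
    {E : ℂ → H → ℂ} (hK : ∀ z : ℂ, 0 < z.re → ∃ M ρ : ℝ, 0 ≤ M ∧ 0 < ρ ∧ ∀ s : ℂ, dist s z < ρ → ∀ k ∈ K, ‖E s k‖ ≤ M)
    (heqv : ∀ s : ℂ, 0 < s.re → ∀ p ∈ P, ∀ x, E s (p * x) = ω s p * E s x) :
    ∀ z : ℂ, 0 < z.re → ∃ C A ρ : ℝ, 0 ≤ C ∧ 0 ≤ A ∧ 0 < ρ ∧ ∀ s : ℂ, dist s z < ρ → ∀ x, ‖E s x‖ ≤ C * height x ^ A := by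
  intro z hz
  obtain ⟨C, A, ρ₁, hC, hA, hρ₁, hωle⟩ := hω z hz
  obtain ⟨M, ρ₂, hM, hρ₂, hKle⟩ := hK z hz
  refine ⟨C * CK ^ A * M, A, min (min ρ₁ ρ₂) z.re, by positivity, hA, lt_min (lt_min hρ₁ hρ₂) hz, fun s hs x => ?_⟩
  have hs₁ : dist s z < ρ₁ := lt_of_lt_of_le hs ((min_le_left _ _).trans (min_le_left _ _))
  have hs₂ : dist s z < ρ₂ := lt_of_lt_of_le hs ((min_le_left _ _).trans (min_le_right _ _))
  have hs0 : 0 < s.re := by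
    have hsz : dist s z < z.re := lt_of_lt_of_le hs (min_le_right _ _)
    have h1 : |s.re - z.re| ≤ dist s z := by
      rw [Complex.dist_eq]; simpa using Complex.abs_re_le_norm (s - z)
    have h2 := (abs_lt.1 (lt_of_le_of_lt h1 hsz)).1
    linarith
  obtain ⟨p, hp, k, hk, rfl⟩ := hIw x
  have hpk : height p ^ A ≤ CK ^ A * height (p * k) ^ A := by
    rw [← Real.mul_rpow hCK (hnn _)]
    exact Real.rpow_le_rpow (hnn p) (hPK p hp k hk) hA
  calc ‖E s (p * k)‖ = ‖ω s p‖ * ‖E s k‖ := by rw [heqv s hs0 p hp k, norm_mul]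
    _ ≤ (C * height p ^ A) * M :=
        mul_le_mul (hωle s hs₁ p hp) (hKle s hs₂ k hk) (norm_nonneg _) (mul_nonneg hC (Real.rpow_nonneg (hnn p) _))
    _ ≤ (C * (CK ^ A * height (p * k) ^ A)) * M :=
        mul_le_mul_of_nonneg_right (mul_le_mul_of_nonneg_left hpk hC) hM
    _ = C * CK ^ A * M * height (p * k) ^ A := by ring

/-! ## §5 Everything from the convergence half-plane -/

/-- **MODERATE GROWTH OF THE CONTINUED BIG CELL, FROM DATA ON THE CONVERGENCE HALF-PLANE.**  For a family `E : ℂ → H → ℂ` holomorphic on `{0 < re}` in `s` for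
every `x` (clause (i)), EQUIVARIANT `E s (p * x) = ω s p · E s x` (`p ∈ P`) and POINT-REPRESENTED on `K` (`E s k = Σ_i E s (kpt i)·ψ i k`, `k ∈ K`) for
`c < re s` (`0 ≤ c`; both: the intertwined section `M(s)f_s ∈ I(−s, χ^w)` of a `K`-finite standard `f`), with `s ↦ ω s p` holomorphic and `‖ω s p‖ ≤ C·height p^A`
near every `z`, `‖ψ i‖ ≤ B` on `K`, `H = P·K`, and `height p ≤ C_K·height (p k)`: the growth clause (v) `‖E s x‖ ≤ C'·height x^{A}` holds near every `z` with
`0 < re z`. [cite: MoeglinWaldspurger1995, I.2.17, II.1.6, IV.1.9] [cite: BorelJacquet1979, §1.2] [cite: Tan1999, §4 Prop. 4.8] -/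
theorem growth_of_equivariance_of_pointRepr {ι : Type*} [Fintype ι] {P K : Set H} (hIw : ∀ x : H, ∃ p ∈ P, ∃ k ∈ K, x = p * k)
    (height : H → ℝ) (hnn : ∀ x, 0 ≤ height x) {CK : ℝ} (hCK : 0 ≤ CK) (hPK : ∀ p ∈ P, ∀ k ∈ K, height p ≤ CK * height (p * k))
    {ω : ℂ → H → ℂ} (hωd : ∀ p ∈ P, DifferentiableOn ℂ (fun s => ω s p) {s : ℂ | 0 < s.re})
    (hω : ∀ z : ℂ, 0 < z.re → ∃ C A ρ : ℝ, 0 ≤ C ∧ 0 ≤ A ∧ 0 < ρ ∧ ∀ s : ℂ, dist s z < ρ → ∀ p ∈ P, ‖ω s p‖ ≤ C * height p ^ A)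
    {E : ℂ → H → ℂ} (hEd : ∀ x, DifferentiableOn ℂ (fun s => E s x) {s : ℂ | 0 < s.re}) {c : ℝ} (hc : 0 ≤ c)
    (heqv : ∀ s : ℂ, c < s.re → ∀ p ∈ P, ∀ x, E s (p * x) = ω s p * E s x)
    {kpt : ι → H} {ψ : ι → H → ℂ} (hrep : ∀ s : ℂ, c < s.re → ∀ k ∈ K, E s k = ∑ i, E s (kpt i) * ψ i k)
    {B : ℝ} (hB : 0 ≤ B) (hψ : ∀ i, ∀ k ∈ K, ‖ψ i k‖ ≤ B) :
    ∀ z : ℂ, 0 < z.re → ∃ C A ρ : ℝ, 0 ≤ C ∧ 0 ≤ A ∧ 0 < ρ ∧ ∀ s : ℂ, dist s z < ρ → ∀ x, ‖E s x‖ ≤ C * height x ^ A :=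
  growth_of_equivariance hIw height hnn hCK hPK hω
    (exists_bound_on_of_pointRepr hEd (pointRepr_of_halfPlane hc hEd hrep) hB hψ)
    (equivariant_of_halfPlane hc hEd hωd heqv)

end Summit.HodgeConjecture.HodgeConjecture.Cruxes.HLiu418.K2LiuBigCellGrowthOfEquivariance

end
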